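import Summits.CriticalPhenomena.PercolationContinuityZ3.Theorems.PercNearOneGluingNoHeavyLowerTailSahiHittingPairSixCertA
import Summits.CriticalPhenomena.PercolationContinuityZ3.Theorems.PercNearOneGluingNoHeavyLowerTailSahiHittingPairSixCertB
import Summits.CriticalPhenomena.PercolationContinuityZ3.Theorems.PercNearOneGluingNoHeavyLowerTailSahiHittingPairSixCertC
import HarnessLib

/-!
# `NoHeavyLowerTail` (stmt-CriticalPhenomena-4575) — the order-6 pair-type hitting polynomial is nonnegative on the unit cube (assembly of the nine slices)

Support file, seat `prim-l12-p5` (gen 9), `--supports stmt-CriticalPhenomena-4575`.  Standard axioms here; computational axioms inherited from the nine slice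
certificates `…SahiHittingPairSixCertA/B/C` (`native_decide`).  No named facts, no sorries.
* **`p6_evalLV_nonneg`** — `0 ≤ evalLV p6Data r` for every `r ∈ [0,1]^{15}`: the universal order-6 hitting polynomial restricted to the 15 pair regions
  (`…SahiHittingPairSixData`: 864 terms) is nonnegative on the cube, i.e. Sahi's `E_6 ≥ 0` for every PAIR-TYPE hitting family (six sets of a product
  space, every coin in exactly two of them — the vertex non-isolation-type events of any weighted multigraph on six vertices) AS A STATEMENT ABOUT THE
  POLYNOMIAL; all `3¹⁵ = 14 348 907` tensor-Bernstein coefficients are `≥ 0` (kit j101758), replayed in the kernel slice by slice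
  (`…SahiHittingBernsteinSlicing.evalLV_nonneg_of_slice2`).
WHAT IS NOT HERE (next step, recorded in the seat's HANDOFF): the bridge `E_6(1_{H_{A_0}},…,1_{H_{A_5}}) = evalLV p6Data r` under the pair-type moment
identities (tree `sahiE_six_moments` + `ex_prod_ind_hit`); its direct symbolic expansion has ≈ 13 000 intermediate monomials and exceeds the farm's
elaboration window, so it needs a reflective polynomial-identity check.  HONEST FRAMING: a certified polynomial inequality; the event-level `C₆` statement
for pair-type families is pending that bridge. [this work]
-/

namespace Summit.CriticalPhenomena.PercolationContinuityZ3.Theorems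

namespace SahiHitting

open Finset SparseBernstein Literature.Combinatorics.Sahi2008

/-! ## `P₆|_{pairs} ≥ 0` on the unit cube, from the nine slices -/

/-- **`P₆|_{pairs} ≥ 0` on `[0,1]^{15}`.** [this work] -/
theorem p6_evalLV_nonneg (r : Fin 15 → ℝ) (hr : ∀ i, 0 ≤ r i ∧ r i ≤ 1) : 0 ≤ evalLV p6Data r := by
  refine evalLV_nonneg_of_slice2 p6Data (fun t ht => ⟨p6_deg_mem t ht 0, p6_deg_mem t ht 1⟩) hr ?_
  intro j0 hj0 j1 hj1
  simp only [Finset.mem_range] at hj0 hj1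
  interval_cases j0 <;> interval_cases j1
  · exact p6_slice_nonneg_00 hr
  · exact p6_slice_nonneg_01 hr
  · exact p6_slice_nonneg_02 hr
  · exact p6_slice_nonneg_10 hr
  · exact p6_slice_nonneg_11 hr
  · exact p6_slice_nonneg_12 hr
  · exact p6_slice_nonneg_20 hr
  · exact p6_slice_nonneg_21 hr
  · exact p6_slice_nonneg_22 hr

end SahiHitting

end Summit.CriticalPhenomena.PercolationContinuityZ3.Theorems
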